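import Mathlib

/-!
# Imbrie (2016), three-spin block: the SPREAD FLOOR on product-pair planes and the second-order
# operators on the umbilic plane `Ω`

[cite: ImbrieJSP2016, eq. (1.1), assumption LLA(ν, C)]  Repair cell b2b-imbrie, LLA.md block P,
P12(a),(b).  Inside a coincident σ₂-sector the three-spin block of [ImbrieJSP2016, eq. (1.1)]
reduces to two dressed qubits `u Z₁ + t₁ X₁ + v Z₃ + t₃ X₃` (spins 1 and 3) plus a weak induced
coupling.  The level-repulsion engine of block P needs, for a resonant pair with eigenplane `P`,
ONE parameter direction `A` whose compression to `P` is not scalar ("spread"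
`√((A₁₁ − A₂₂)² + 4A₁₂²) ≥ c`).

* PRODUCT-PAIR PLANES (the crossing `e₁ = e₃` of the decoupled qubits): `P = span{x ⊗ y′, x′ ⊗ y}`
  with `x = (cos θ, sin θ)`, `x′ = (−sin θ, cos θ)` and likewise `y, y′` (angle `φ`).  On `P` the
  directions `Z₁` (↔ `u`) and `X₁` (↔ `t₁`) have ZERO cross term and diagonal entries
  `± cos 2θ`, `± sin 2θ`; hence `spread_{Z₁}² + spread_{X₁}² = 4·(cos²2θ + sin²2θ) = 4` and one of
  the two spreads is `≥ √2`: an ABSOLUTE floor, whatever `u, v, t`.  (`theorem productPair_*`.)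
* THE UMBILIC PLANE `Ω = span{Ψ⁺, Φ⁻}` (`Ψ⁺ = (|+−⟩ + |−+⟩)/√2`, `Φ⁻ = (|++⟩ − |−−⟩)/√2`, spins
  1, 3): all four first-order directions `Z₁, Z₃, X₁, X₃` have zero matrix elements within `Ω`
  (this is `UmbilicPlanes` restricted to a sector), while the SECOND-ORDER operators do not:
  `Z₁Z₃ ↦ diag(−1, 1)`, `X₁X₃ ↦ diag(1, −1)`, `X₁Z₃, Z₁X₃ ↦ σₓ` in the basis `(Ψ⁺, Φ⁻)` — the
  operators through which the far sector splits an `Ω`-like pair (LLA.md P10(c), P12(d)).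

Two-qubit kets are real functions of two basis indices; finite identities, no analysis.
-/

namespace Literature.MathematicalPhysics.QuantumLattice.Imbrie2016

open Finset BigOperators Real

namespace ProductPairSpread

/-- [cite: ImbrieJSP2016, eq. (1.1)] spin value of a basis index: `0 ↦ +1`, `1 ↦ −1`. -/
def sgn : Fin 2 → ℝ := ![1, -1]

/-- [cite: ImbrieJSP2016, eq. (1.1)] two-qubit kets (spins 1 and 3 of a σ₂-sector) as real functions of two indices. -/
abbrev Ket₂ := Fin 2 → Fin 2 → ℝ

/-- [cite: ImbrieJSP2016, eq. (1.1)] real inner product. -/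
def inner (φ ψ : Ket₂) : ℝ := ∑ a, ∑ c, φ a c * ψ a c

/-- [cite: ImbrieJSP2016, eq. (1.1)] `Z₁`. -/
def Z₁ (ψ : Ket₂) : Ket₂ := fun a c => sgn a * ψ a c
/-- [cite: ImbrieJSP2016, eq. (1.1)] `Z₃`. -/
def Z₃ (ψ : Ket₂) : Ket₂ := fun a c => sgn c * ψ a c
/-- [cite: ImbrieJSP2016, eq. (1.1)] `X₁`. -/
def X₁ (ψ : Ket₂) : Ket₂ := fun a c => ψ a.rev c
/-- [cite: ImbrieJSP2016, eq. (1.1)] `X₃`. -/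
def X₃ (ψ : Ket₂) : Ket₂ := fun a c => ψ a c.rev

/-- [cite: ImbrieJSP2016, eq. (1.1)] a one-qubit real unit vector at Bloch angle `θ`, as a function of the index. -/
noncomputable def bloch (θ : ℝ) : Fin 2 → ℝ := ![Real.cos θ, Real.sin θ]
/-- [cite: ImbrieJSP2016, eq. (1.1)] its orthogonal partner (angle `θ + π/2`). -/
noncomputable def blochPerp (θ : ℝ) : Fin 2 → ℝ := ![-Real.sin θ, Real.cos θ]

/-- [cite: ImbrieJSP2016, eq. (1.1)] first member of the product pair: `x ⊗ y′`. -/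
noncomputable def pp₁ (θ φ : ℝ) : Ket₂ := fun a c => bloch θ a * blochPerp φ c
/-- [cite: ImbrieJSP2016, eq. (1.1)] second member of the product pair: `x′ ⊗ y`. -/
noncomputable def pp₂ (θ φ : ℝ) : Ket₂ := fun a c => blochPerp θ a * bloch φ c

/-- [cite: ImbrieJSP2016, eq. (1.1)] the product pair is orthonormal. -/
theorem productPair_orthonormal (θ φ : ℝ) :
    inner (pp₁ θ φ) (pp₁ θ φ) = 1 ∧ inner (pp₂ θ φ) (pp₂ θ φ) = 1 ∧ inner (pp₁ θ φ) (pp₂ θ φ) = 0 := by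
  have h1 := Real.sin_sq_add_cos_sq θ
  have h2 := Real.sin_sq_add_cos_sq φ
  refine ⟨?_, ?_, ?_⟩ <;> simp only [inner, pp₁, pp₂, bloch, blochPerp, Fin.sum_univ_two, Matrix.cons_val_zero, Matrix.cons_val_one]
  · linear_combination (Real.sin θ ^ 2 + Real.cos θ ^ 2) * h2 + h1
  · linear_combination (Real.sin θ ^ 2 + Real.cos θ ^ 2) * h2 + h1
  · ring

/-- [cite: ImbrieJSP2016, eq. (1.1)] `Z₁` on the product pair: zero cross term, diagonal entries `± cos 2θ`
(written as `±(cos²θ − sin²θ)`). -/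
theorem productPair_Z₁ (θ φ : ℝ) :
    inner (pp₁ θ φ) (Z₁ (pp₂ θ φ)) = 0 ∧
      inner (pp₁ θ φ) (Z₁ (pp₁ θ φ)) = Real.cos θ ^ 2 - Real.sin θ ^ 2 ∧
      inner (pp₂ θ φ) (Z₁ (pp₂ θ φ)) = -(Real.cos θ ^ 2 - Real.sin θ ^ 2) := by
  have h2 := Real.sin_sq_add_cos_sq φ
  refine ⟨?_, ?_, ?_⟩ <;> simp only [inner, Z₁, pp₁, pp₂, bloch, blochPerp, sgn, Fin.sum_univ_two, Matrix.cons_val_zero, Matrix.cons_val_one]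
  · ring
  · linear_combination (Real.cos θ ^ 2 - Real.sin θ ^ 2) * h2
  · linear_combination (-(Real.cos θ ^ 2 - Real.sin θ ^ 2)) * h2

/-- [cite: ImbrieJSP2016, eq. (1.1)] `X₁` on the product pair: zero cross term, diagonal entries `± sin 2θ`
(written as `± 2 sin θ cos θ`). -/
theorem productPair_X₁ (θ φ : ℝ) :
    inner (pp₁ θ φ) (X₁ (pp₂ θ φ)) = 0 ∧
      inner (pp₁ θ φ) (X₁ (pp₁ θ φ)) = 2 * Real.sin θ * Real.cos θ ∧
      inner (pp₂ θ φ) (X₁ (pp₂ θ φ)) = -(2 * Real.sin θ * Real.cos θ) := by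
  have h2 := Real.sin_sq_add_cos_sq φ
  have r0 : (0 : Fin 2).rev = 1 := by decide
  have r1 : (1 : Fin 2).rev = 0 := by decide
  refine ⟨?_, ?_, ?_⟩ <;> simp only [inner, X₁, pp₁, pp₂, bloch, blochPerp, Fin.sum_univ_two, r0, r1, Matrix.cons_val_zero, Matrix.cons_val_one]
  · ring
  · linear_combination (2 * Real.sin θ * Real.cos θ) * h2
  · linear_combination (-(2 * Real.sin θ * Real.cos θ)) * h2

/-- [cite: ImbrieJSP2016, eq. (1.1)] THE SPREAD FLOOR: with `spread² = (A₁₁ − A₂₂)² + 4A₁₂²` and the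
entries above, `spread_{Z₁}² + spread_{X₁}² = 4(cos²θ − sin²θ)² + 4(2 sin θ cos θ)² = 4`; hence
`max(spread_{Z₁}, spread_{X₁}) ≥ √2` on every product-pair plane. Stated as the algebraic identity and
the resulting alternative `(cos²θ − sin²θ)² ≥ 1/2 ∨ (2 sin θ cos θ)² ≥ 1/2`. -/
theorem productPair_spread_floor (θ : ℝ) :
    (2 * (Real.cos θ ^ 2 - Real.sin θ ^ 2)) ^ 2 + (2 * (2 * Real.sin θ * Real.cos θ)) ^ 2 = 4 ∧
      ((Real.cos θ ^ 2 - Real.sin θ ^ 2) ^ 2 ≥ 1 / 2 ∨ (2 * Real.sin θ * Real.cos θ) ^ 2 ≥ 1 / 2) := by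
  have h1 := Real.sin_sq_add_cos_sq θ
  have key : (Real.cos θ ^ 2 - Real.sin θ ^ 2) ^ 2 + (2 * Real.sin θ * Real.cos θ) ^ 2 = 1 := by
    nlinarith [h1]
  refine ⟨by linear_combination 4 * key, ?_⟩
  rcases le_or_gt (1 / 2 : ℝ) ((Real.cos θ ^ 2 - Real.sin θ ^ 2) ^ 2) with h | h
  · exact Or.inl h
  · exact Or.inr (by linarith [key])

/-- [cite: ImbrieJSP2016, eq. (1.1)] `Ψ⁺ = (|+−⟩ + |−+⟩)` un-normalised (entries 0/1). -/
def PsiPlus : Ket₂ := ![![0, 1], ![1, 0]]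
/-- [cite: ImbrieJSP2016, eq. (1.1)] `Φ⁻ = (|++⟩ − |−−⟩)` un-normalised (entries 0/±1). -/
def PhiMinus : Ket₂ := ![![1, 0], ![0, -1]]

/-- [cite: ImbrieJSP2016, eq. (1.1)] `Ψ⁺, Φ⁻` are orthogonal with squared norm 2 (so `Ω = span{Ψ⁺, Φ⁻}`
and the matrices below are compressions up to the factor 2). -/
theorem omega_basis : inner PsiPlus PhiMinus = 0 ∧ inner PsiPlus PsiPlus = 2 ∧ inner PhiMinus PhiMinus = 2 := by
  refine ⟨?_, ?_, ?_⟩ <;> norm_num [inner, PsiPlus, PhiMinus, Fin.sum_univ_two, Matrix.cons_val_zero, Matrix.cons_val_one, Matrix.head_cons]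

/-- [cite: ImbrieJSP2016, eq. (1.1)] FIRST-ORDER UMBILICITY of `Ω`: `Z₁, Z₃, X₁, X₃` have all matrix
elements zero within `Ω` (diagonal and cross). -/
theorem omega_firstOrder_zero :
    (inner PsiPlus (Z₁ PsiPlus) = 0 ∧ inner PhiMinus (Z₁ PhiMinus) = 0 ∧ inner PsiPlus (Z₁ PhiMinus) = 0) ∧
    (inner PsiPlus (Z₃ PsiPlus) = 0 ∧ inner PhiMinus (Z₃ PhiMinus) = 0 ∧ inner PsiPlus (Z₃ PhiMinus) = 0) ∧
    (inner PsiPlus (X₁ PsiPlus) = 0 ∧ inner PhiMinus (X₁ PhiMinus) = 0 ∧ inner PsiPlus (X₁ PhiMinus) = 0) ∧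
    (inner PsiPlus (X₃ PsiPlus) = 0 ∧ inner PhiMinus (X₃ PhiMinus) = 0 ∧ inner PsiPlus (X₃ PhiMinus) = 0) := by
  have r0 : (0 : Fin 2).rev = 1 := by decide
  have r1 : (1 : Fin 2).rev = 0 := by decide
  refine ⟨⟨?_, ?_, ?_⟩, ⟨?_, ?_, ?_⟩, ⟨?_, ?_, ?_⟩, ⟨?_, ?_, ?_⟩⟩ <;>
    norm_num [inner, Z₁, Z₃, X₁, X₃, PsiPlus, PhiMinus, sgn, Fin.sum_univ_two, r0, r1, Matrix.cons_val_zero, Matrix.cons_val_one, Matrix.head_cons]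

/-- [cite: ImbrieJSP2016, eq. (1.1)] SECOND-ORDER operators on `Ω` (un-normalised basis, entries ×2):
`Z₁Z₃ ↦ diag(−2, 2)`, `X₁X₃ ↦ diag(2, −2)` (zero cross terms) — the operators that split an `Ω`-pair. -/
theorem omega_secondOrder_diag :
    (inner PsiPlus (Z₁ (Z₃ PsiPlus)) = -2 ∧ inner PhiMinus (Z₁ (Z₃ PhiMinus)) = 2 ∧ inner PsiPlus (Z₁ (Z₃ PhiMinus)) = 0) ∧
    (inner PsiPlus (X₁ (X₃ PsiPlus)) = 2 ∧ inner PhiMinus (X₁ (X₃ PhiMinus)) = -2 ∧ inner PsiPlus (X₁ (X₃ PhiMinus)) = 0) := by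
  have r0 : (0 : Fin 2).rev = 1 := by decide
  have r1 : (1 : Fin 2).rev = 0 := by decide
  refine ⟨⟨?_, ?_, ?_⟩, ⟨?_, ?_, ?_⟩⟩ <;>
    norm_num [inner, Z₁, Z₃, X₁, X₃, PsiPlus, PhiMinus, sgn, Fin.sum_univ_two, r0, r1, Matrix.cons_val_zero, Matrix.cons_val_one, Matrix.head_cons]

/-- [cite: ImbrieJSP2016, eq. (1.1)] SECOND-ORDER operators on `Ω`, off-diagonal type: `X₁Z₃` and `Z₁X₃`
have zero diagonal entries and cross term `2` (i.e. `↦ σₓ` after normalisation). -/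
theorem omega_secondOrder_offdiag :
    (inner PsiPlus (X₁ (Z₃ PsiPlus)) = 0 ∧ inner PhiMinus (X₁ (Z₃ PhiMinus)) = 0 ∧ inner PsiPlus (X₁ (Z₃ PhiMinus)) = 2) ∧
    (inner PsiPlus (Z₁ (X₃ PsiPlus)) = 0 ∧ inner PhiMinus (Z₁ (X₃ PhiMinus)) = 0 ∧ inner PsiPlus (Z₁ (X₃ PhiMinus)) = 2) := by
  have r0 : (0 : Fin 2).rev = 1 := by decide
  have r1 : (1 : Fin 2).rev = 0 := by decide
  refine ⟨⟨?_, ?_, ?_⟩, ⟨?_, ?_, ?_⟩⟩ <;>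
    norm_num [inner, Z₁, Z₃, X₁, X₃, PsiPlus, PhiMinus, sgn, Fin.sum_univ_two, r0, r1, Matrix.cons_val_zero, Matrix.cons_val_one, Matrix.head_cons]

end ProductPairSpread

end Literature.MathematicalPhysics.QuantumLattice.Imbrie2016
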